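import Summits.MatrixMultiplication.OmegaCensus.DominoStructureTPP
import HarnessLib

/-!
# The symmetric reduced form of a domino cube law triple (odd-order `A`)

ω-census `pub-omega`, family (b3), seat pub-omega-group gen 7.  Framing: lottery ticket; floor = certified bounds/negative
ranges.  VALUE: the kernel form of step R1 of the cell's Radon certificates (`THEORY-radon-g7.md`); NOT progress on ω.

**Theorem (`domino_symmetric_form_of_law`).** Let `G` be dihedral-like over a finite abelian group `A` in which every
element is a double (`∀ c, ∃ a, a + a = c`; e.g. `|A|` odd), any `c₀`.  If a TPP triple `(S,T,U)` has coset parts of sizes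
`(1,1 | d,d | e,e)` and attains the law `3|S||T||U| + 8 = 8|A|`, then there are `X, Y ⊆ A` with `|X| = d`, `|Y| = e`,
a point `x₀`, such that the sumset `X + Y` is direct and the three sets `X + Y`, `Y − X`, `X − Y` are pairwise disjoint
with union `A ∖ {x₀}` — the SYMMETRIC REDUCED PROBLEM `(X+Y) ⊔ (Y−X) ⊔ (X−Y) = A ∖ {x₀}` whose line projections the
Radon engine enumerates (`RadonProjection.radon_identity` is the fibre identity it satisfies).
Proof: `domino_structure_of_law` (`T₁ = κ − T₀`, `U₁ = κ′ − U₀`), the vertex-`000` packing of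
`DihedralLikeTPPBound` (the plain sumsets `S₁+T₀+U₀`, `S₀+T₁+U₀`, `S₀+T₀+U₁` are direct, pairwise disjoint, of total size
`|A| − 1`), and the translations `X = T₀ + a`, `Y = U₀ + b` with `2a = s′ − s − κ`, `2b = s′ − s − κ′`.
-/

namespace Summit.MatrixMultiplication.OmegaCensus

open Literature.Combinatorics.Additive Finset

section Helper

variable {A : Type*} [DecidableEq A] [Fintype A]

/-- Three (or any) finite sets whose complement is a singleton cover the rest. [folklore] -/
theorem union_eq_erase_of_sdiff_eq_singleton {P Q R : Finset A} {x : A}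
    (h : univ \ (P ∪ Q ∪ R) = {x}) : P ∪ Q ∪ R = univ.erase x := by
  ext a
  have ha : a ∈ univ \ (P ∪ Q ∪ R) ↔ a ∈ ({x} : Finset A) := by rw [h]
  simp only [mem_sdiff, mem_univ, true_and, mem_singleton] at ha
  simp only [mem_erase, mem_univ, and_true]
  tauto

end Helper

section DihedralLike

variable {A : Type*} [AddCommGroup A] [DecidableEq A] [Fintype A] {G : Type} [Group G] [DecidableEq G]
  {ρ τ : A → G} {c₀ : A} {S T U : Finset G}

/-- **Symmetric reduced form of a domino cube law triple.** [folklore] -/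
theorem domino_symmetric_form_of_law
    (hρρ : ∀ a b, ρ a * ρ b = ρ (a + b)) (hρτ : ∀ a b, ρ a * τ b = τ (b - a))
    (hτρ : ∀ a b, τ a * ρ b = τ (a + b)) (hττ : ∀ a b, τ a * τ b = ρ (c₀ + b - a))
    (hρ : Function.Injective ρ) (hτ : Function.Injective τ) (hne : ∀ a b, ρ a ≠ τ b)
    (hsurj : ∀ g, (∃ a, ρ a = g) ∨ (∃ a, τ a = g)) (hhalf : ∀ c : A, ∃ a : A, a + a = c)
    (h : TripleProductProperty S T U)
    (hS₀ : (univ.filter fun a : A => ρ a ∈ S).card = 1) (hS₁ : (univ.filter fun a : A => τ a ∈ S).card = 1)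
    (hT : (univ.filter fun a : A => ρ a ∈ T).card = (univ.filter fun a : A => τ a ∈ T).card)
    (hU : (univ.filter fun a : A => ρ a ∈ U).card = (univ.filter fun a : A => τ a ∈ U).card)
    (hV : 3 * (S.card * T.card * U.card) + 8 = 8 * Fintype.card A) :
    ∃ (X Y : Finset A) (x₀ : A), X.card = (univ.filter fun a : A => ρ a ∈ T).card ∧
      Y.card = (univ.filter fun a : A => ρ a ∈ U).card ∧
      Set.InjOn (fun p : A × A => p.1 + p.2) ↑(X ×ˢ Y) ∧
      Disjoint ((X ×ˢ Y).image fun p : A × A => p.1 + p.2) ((Y ×ˢ X).image fun p : A × A => p.1 - p.2) ∧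
      Disjoint ((X ×ˢ Y).image fun p : A × A => p.1 + p.2) ((X ×ˢ Y).image fun p : A × A => p.1 - p.2) ∧
      Disjoint ((Y ×ˢ X).image fun p : A × A => p.1 - p.2) ((X ×ˢ Y).image fun p : A × A => p.1 - p.2) ∧
      ((X ×ˢ Y).image fun p : A × A => p.1 + p.2) ∪ ((Y ×ˢ X).image fun p : A × A => p.1 - p.2) ∪
        ((X ×ˢ Y).image fun p : A × A => p.1 - p.2) = univ.erase x₀ := by
  set T₀ : Finset A := univ.filter fun a => ρ a ∈ T with hT₀
  set T₁ : Finset A := univ.filter fun a => τ a ∈ T with hT₁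
  set U₀ : Finset A := univ.filter fun a => ρ a ∈ U with hU₀
  set U₁ : Finset A := univ.filter fun a => τ a ∈ U with hU₁
  obtain ⟨κ, κ', hκ, hκ'⟩ := domino_structure_of_law hρρ hρτ hτρ hττ hρ hτ hne hsurj h hS₀ hS₁ hT hU hV
  obtain ⟨s, hs⟩ := card_eq_one.1 hS₀
  obtain ⟨s', hs'⟩ := card_eq_one.1 hS₁
  -- membership facts for the sumset lemmas
  have mS₀ : ∀ a ∈ ({s} : Finset A), ρ a ∈ S := fun a ha => by
    have : a ∈ univ.filter fun a : A => ρ a ∈ S := by rw [hs]; exact ha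
    simpa using this
  have mS₁ : ∀ a ∈ ({s'} : Finset A), τ a ∈ S := fun a ha => by
    have : a ∈ univ.filter fun a : A => τ a ∈ S := by rw [hs']; exact ha
    simpa using this
  have mS₀c : ∀ a ∈ ({s} : Finset A), cond false (τ a) (ρ a) ∈ S := fun a ha => by simpa using mS₀ a ha
  have mS₁c : ∀ a ∈ ({s'} : Finset A), cond true (τ a) (ρ a) ∈ S := fun a ha => by simpa using mS₁ a ha
  have mT₀ : ∀ a ∈ T₀, ρ a ∈ T := fun a ha => by simpa [hT₀] using ha
  have mT₁ : ∀ a ∈ T₁, τ a ∈ T := fun a ha => by simpa [hT₁] using ha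
  have mU₀ : ∀ a ∈ U₀, ρ a ∈ U := fun a ha => by simpa [hU₀] using ha
  have mU₁ : ∀ a ∈ U₁, τ a ∈ U := fun a ha => by simpa [hU₁] using ha
  have mT₀c : ∀ a ∈ T₀, cond false (τ a) (ρ a) ∈ T := fun a ha => by simpa using mT₀ a ha
  have mU₀c : ∀ a ∈ U₀, cond false (τ a) (ρ a) ∈ U := fun a ha => by simpa using mU₀ a ha
  have mU₁c : ∀ a ∈ U₁, cond true (τ a) (ρ a) ∈ U := fun a ha => by simpa using mU₁ a ha
  -- numerics
  have cS := card_eq_parts' hρ hτ hne hsurj S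
  have cT := card_eq_parts' hρ hτ hne hsurj T
  have cU := card_eq_parts' hρ hτ hne hsurj U
  rw [hS₀, hS₁] at cS
  have hprod : S.card * T.card * U.card = 8 * (T₀.card * U₀.card) := by
    rw [cS, cT, cU, ← hT, ← hU]; ring
  rw [hprod] at hV
  have hn : 3 * (T₀.card * U₀.card) + 1 = Fintype.card A := by omega
  -- the three vertex-000 boxes `B1 = s' + T₀ + U₀`, `B2 = s + T₁ + U₀`, `B3 = s + T₀ + U₁`
  have inj := sum_injOn' hρρ hττ hρ hτ h
  have i₀₀ := injOn₂_of_injOn₃_singleton s' T₀ U₀ (inj true false false mS₁c mT₀c mU₀c)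
  have i₁₀ := injOn₂_of_injOn₃_singleton s T₁ U₀ (inj false true false mS₀c (fun a ha => by simpa using mT₁ a ha) mU₀c)
  have i₀₁ := injOn₂_of_injOn₃_singleton s T₀ U₁ (inj false false true mS₀c mT₀c mU₁c)
  have d₁ := disjoint_sumset₁' hρρ hρτ hτρ hττ hne h false mS₁ mT₀ mU₀c mS₀ mT₁
  have d₃ := disjoint_sumset₂' hρρ hρτ hτρ hττ hne h false mS₀c mT₁ mU₀ mS₀c mT₀ mU₁
  have d₂ := disjoint_sumset₃' hρρ hρτ hτρ hττ hne h false mS₀ mT₀c mU₁ mS₁ mU₀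
  rw [sumset₃_singleton, sumset₃_singleton] at d₁ d₂ d₃
  have hκ1 : T₁ = T₀.image (fun t => κ - t) := hκ
  have hκ'1 : U₁ = U₀.image (fun u => κ' - u) := hκ'
  rw [hκ1] at d₁ d₃ i₁₀
  rw [hκ'1] at d₂ d₃ i₀₁
  set B1 := ((T₀ ×ˢ U₀).image fun p : A × A => p.1 + p.2).image (fun z => z + s') with hB1
  set B2 := (((T₀.image fun t => κ - t) ×ˢ U₀).image fun p : A × A => p.1 + p.2).image (fun z => z + s) with hB2
  set B3 := ((T₀ ×ˢ (U₀.image fun u => κ' - u)).image fun p : A × A => p.1 + p.2).image (fun z => z + s) with hB3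
  have cB1 : B1.card = T₀.card * U₀.card := by
    rw [hB1, card_image_of_injective _ (add_left_injective s'), card_sumset₂ i₀₀]
  have cB2 : B2.card = T₀.card * U₀.card := by
    rw [hB2, card_image_of_injective _ (add_left_injective s), card_sumset₂ i₁₀,
      card_image_of_injective _ (sub_right_injective)]
  have cB3 : B3.card = T₀.card * U₀.card := by
    rw [hB3, card_image_of_injective _ (add_left_injective s), card_sumset₂ i₀₁,
      card_image_of_injective _ (sub_right_injective)]
  obtain ⟨x₁, hx₁⟩ := exists_missed_point d₁ d₂.symm d₃ (by rw [cB1, cB2, cB3]; omega)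
  have hcov : B1 ∪ B2 ∪ B3 = univ.erase x₁ := union_eq_erase_of_sdiff_eq_singleton hx₁
  -- halves
  obtain ⟨a, ha⟩ := hhalf (s' - s - κ)
  obtain ⟨b, hb⟩ := hhalf (s' - s - κ')
  set z : A := s' - a - b with hz
  set X : Finset A := T₀.image fun x => x + a with hX
  set Y : Finset A := U₀.image fun y => y + b with hY
  -- the three reduced boxes are translates of B1, B2, B3 by `−z`
  have eP : ((X ×ˢ Y).image fun p : A × A => p.1 + p.2).image (fun w => w + z) = B1 := by
    rw [hX, hY, sumset₂_image_add_left, sumset₂_image_add_right, image_add_image_add, image_add_image_add, hB1]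
    congr 1; funext w; rw [hz]; abel
  have eQ : ((Y ×ˢ X).image fun p : A × A => p.1 - p.2).image (fun w => w + z) = B2 := by
    ext w
    simp only [hX, hY, hB2, mem_image, mem_product, Prod.exists]
    constructor
    · rintro ⟨w', ⟨y', x', ⟨⟨u, hu, rfl⟩, ⟨t, ht, rfl⟩⟩, rfl⟩, rfl⟩
      refine ⟨κ - t + u, ⟨κ - t, u, ⟨⟨t, ht, rfl⟩, hu⟩, rfl⟩, ?_⟩
      have e : u + b - (t + a) + z - (κ - t + u + s) = (s' - s - κ) - (a + a) := by rw [hz]; abel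
      rw [ha, sub_self, sub_eq_zero] at e
      exact e.symm
    · rintro ⟨w', ⟨t', u, ⟨⟨t, ht, rfl⟩, hu⟩, rfl⟩, rfl⟩
      refine ⟨u + b - (t + a), ⟨u + b, t + a, ⟨⟨u, hu, rfl⟩, ⟨t, ht, rfl⟩⟩, rfl⟩, ?_⟩
      have e : u + b - (t + a) + z - (κ - t + u + s) = (s' - s - κ) - (a + a) := by rw [hz]; abel
      rw [ha, sub_self, sub_eq_zero] at e
      exact e
  have eR : ((X ×ˢ Y).image fun p : A × A => p.1 - p.2).image (fun w => w + z) = B3 := by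
    ext w
    simp only [hX, hY, hB3, mem_image, mem_product, Prod.exists]
    constructor
    · rintro ⟨w', ⟨x', y', ⟨⟨t, ht, rfl⟩, ⟨u, hu, rfl⟩⟩, rfl⟩, rfl⟩
      refine ⟨t + (κ' - u), ⟨t, κ' - u, ⟨ht, ⟨u, hu, rfl⟩⟩, rfl⟩, ?_⟩
      have e : t + a - (u + b) + z - (t + (κ' - u) + s) = (s' - s - κ') - (b + b) := by rw [hz]; abel
      rw [hb, sub_self, sub_eq_zero] at e
      exact e.symm
    · rintro ⟨w', ⟨t, u', ⟨ht, ⟨u, hu, rfl⟩⟩, rfl⟩, rfl⟩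
      refine ⟨t + a - (u + b), ⟨t + a, u + b, ⟨⟨t, ht, rfl⟩, ⟨u, hu, rfl⟩⟩, rfl⟩, ?_⟩
      have e : t + a - (u + b) + z - (t + (κ' - u) + s) = (s' - s - κ') - (b + b) := by rw [hz]; abel
      rw [hb, sub_self, sub_eq_zero] at e
      exact e
  refine ⟨X, Y, x₁ - z, ?_, ?_, ?_, ?_, ?_, ?_, ?_⟩
  · rw [hX, card_image_of_injective _ (add_left_injective a)]
  · rw [hY, card_image_of_injective _ (add_left_injective b)]
  · exact injOn_sumset₂_image_add_left a (injOn_sumset₂_image_add_right b i₀₀)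
  · refine disjoint_of_disjoint_image_add z ?_
    rw [eP, eQ]; exact d₁
  · refine disjoint_of_disjoint_image_add z ?_
    rw [eP, eR]; exact d₂.symm
  · refine disjoint_of_disjoint_image_add z ?_
    rw [eQ, eR]; exact d₃
  · ext w
    have key : w + z ∈ B1 ∪ B2 ∪ B3 ↔ w + z ∈ univ.erase x₁ := by rw [hcov]
    rw [← eP, ← eQ, ← eR] at key
    simp only [mem_union, (add_left_injective z).mem_finset_image, mem_erase, mem_univ, and_true] at key
    simp only [mem_union, mem_erase, mem_univ, and_true]
    rw [key]
    constructor
    · intro hw hc; exact hw (by rw [hc]; abel)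
    · intro hw hc; exact hw (by rw [← hc]; abel)

end DihedralLike

end Summit.MatrixMultiplication.OmegaCensus
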